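import Summits.QuantumFields.YangMills.Theorems.BalabanUVNodesN15KingModelGraphPowerCountingKruskal
import Summits.QuantumFields.YangMills.Theorems.BalabanUVNodesN15KingModelGraphPowerCountingProp36R

/-!
# BalabanUVNodes ∕ N15 — THE KING-MODEL RUNG (PART Γ-l): **KRUSKAL's CERTIFICATE AND PROPOSITION 3.6 (3.56) FOR CONNECTED GRAPHS IN KING's OWN HYPOTHESIS (3.77)**
# — for a connected graph and every ordering there IS a relabelled spanning-forest certificate whose tree lines are exactly Kruskal's (breadth-first numbering
# of Kruskal's tree), so part Γ-i's certificates are DISCHARGED: it suffices that King's degrees `D(H_i)` — partial sums of `e_ℓ + (d+1)·[l(i) reaches a new point]`,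
# computed from the ordering alone — exceed a margin along every ordering
# (Track A, DAG node N15 = NE2; FAN-OUT v1.1 §N15 s3 «KING-MODEL RUNG … NE2's analogue DECIDED in the model»)

HONEST FRAMING.  Count-neutral (cell `pub-ymgap`, seat `pub-ymgap-dag-n15-e` g27; `--supports stmt-QuantumFields-27366 --as helper` = K3⁸
`SpineGivenEndpointR13SepCoPHV`).  TEMPLATE LITERATURE: C. King, *The U(1) Higgs model. I. The continuum limit*, Commun. Math. Phys. **102** (1986) 649–677
[King1986], Proposition 3.6 (3.56) p. 662, its proof pp. 663–665, and §3.5 (3.77) p. 666 («D(H_i) > 0 for 1 ≤ i ≤ m₁»).  Part Γ-k typed King's shrinking as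
Kruskal labels (tree lines, connectivity, `nn` tree lines for a connected graph); THIS FILE builds from any connecting line set the breadth-first certificate
(distance from the external vertex by `Nat.find`, parent, tree line, the numbering by `Tuple.sort` of (distance, index) — the pattern of the tree's
`SchreierTreeBFS` for coset graphs, re-done for flat multigraphs), shows that on Kruskal's tree its tree lines are ALL of Kruskal's (injectivity + counting), and
restates part Γ-i's ★★★ theorem with the certificates discharged.  King's U(1)∕`A = 0` MODEL in §3; NOT Bałaban's non-abelian `G(U)` of [B9]; NOT a node
discharge; nothing continuum ∕ ℝ⁴ ∕ OS ∕ mass-gap ∕ Clay.  0 `sorry`; standard axioms.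
THE PRINT.  p. 664 [PDF 16]: *«Some of the subgraphs H_i may be divergent. In Sect. 3.5, we will show how graphs may be added together to form renormalised graphs,
in which every subgraph has positive degree. We will assume below that this has been done already … Let x, y be the endpoints of the graph H₁ = l(1) … We then
sum over y … we get altogether the exponent D(H₁) … Graphically, we have shrunk l(1) to a point in H … eventually shrinking H to one point x.»*; p. 666 [PDF 18]:
*«Then the renormalised graphs {H_ren} produced after cancelling divergences for this ordering l have the following properties; (i) D(H_i) > 0 for 1 ≤ i ≤ m₁ (3.77)»*.
WHAT THIS FILE PROVES.
* §1 (ns `…Graph`) `LAdjU`, `ReachIn T k v` (reached from `0` by `≤ k` lines of `T`), `reachIn_mono`∕`_step`, ★ `exists_reachIn_of_lConn`; `bdist` (`Nat.find`),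
  `reachIn_bdist`, `bdist_le`, `bdist_eq_zero_iff`, ★ `exists_parent`, `bparent`∕`bline` (+ `bdist_bparent_lt`, `bline_mem`, `bline_ends`), ★ `bline_injective`;
  `bkey`∕`bnum` (the breadth-first numbering, `Tuple.sort`), `bnum_lt_of_bkey_lt`, `bnum_bparent_lt`, ★ `bnum_zero`, `bnum_symm_succ_ne_zero`; ★★ **`bfsCertR hT :
  ForestCertR nn src tgt`** (the certificate of ANY line set `T` connecting every vertex to `0`), `image_bfsCertR_subset`, `card_image_bfsCertR`.
* §2 ★★★ **`exists_certR_kruskal`** — for a connected graph and every ordering `π`: `∃ FR : ForestCertR nn src tgt, image FR.F.tl = kruskalTree src tgt π`.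
* §3 (ns `…Curved`) `kingDegList src tgt dV e π` (KING's EXPONENT LIST OF AN ORDERING: `e + dV` at the positions reaching a new point, `e` at the loop-closing ones;
  partial sums = `D(H_i)`), `orderList_eq_kingDegList`; ★★★ **`king_prop36_graph_zeroField_kruskal`** — part Γ-i's Prop. 3.6 (3.56) with the certificates
  DISCHARGED: for a CONNECTED numbered graph (`∀ v, LConn src tgt univ 0 v`) it suffices that `PosDegreesBy γ₁ (kingDegList src tgt (d+1) (lineExp ∘ κ) π)` for every
  ordering `π` — King's (3.77) with a margin; same constants `(C₁, C₂, γ₀)` and bound as `king_prop36_graph_zeroField_R`.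
HONEST SCOPE.  (a) The positivity (3.77) itself — King's §3.5 ∕ [Ba3] cancellation of divergences — remains the HYPOTHESIS (NOT typed); everything else in the
chain Γ-a…Γ-l is proved.  (b) Connected graphs (King's are); `G`∕`∂G` lines; abstract one-vertex factors; (3.56)'s external tree decay not displayed.  (c) King's
U(1)∕`A = 0` model; NOT Bałaban's `G(U)`; NE2∕N15 of record untouched; counts unmoved.  Locators: [King1986] Prop. 3.6 (3.56) p.662, (3.58) p.663, (3.66) p.663
(foot), (3.67)–(3.70) p.664, (3.77) p.666, pp.664–665.
-/
noncomputable section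

namespace Summit.QuantumFields.YangMills.BalabanUVNodes.N15KingModelRung.Graph

open scoped BigOperators
open Finset

/-! ## §1 Breadth-first distances and parents in a connecting set of lines -/

section BFS
variable {nn m : ℕ} (src tgt : Fin m → Fin (nn + 1)) (T : Finset (Fin m))

/-- symmetric adjacency through a set of lines. [folklore] -/
def LAdjU (u v : Fin (nn + 1)) : Prop := ∃ ℓ ∈ T, (src ℓ = u ∧ tgt ℓ = v) ∨ (src ℓ = v ∧ tgt ℓ = u)

/-- `ReachIn k v`: the vertex `v` is reached from the external vertex `0` by a chain of at most `k` lines of `T`. [folklore] -/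
def ReachIn : ℕ → Fin (nn + 1) → Prop
  | 0, v => v = 0
  | k + 1, v => ReachIn k v ∨ ∃ w, ReachIn k w ∧ LAdjU src tgt T w v

variable {src tgt T}

/-- one more step never hurts. [folklore] -/
theorem reachIn_succ {k : ℕ} {v : Fin (nn + 1)} (h : ReachIn src tgt T k v) : ReachIn src tgt T (k + 1) v := Or.inl h

/-- monotonicity in the number of steps. [folklore] -/
theorem reachIn_mono {k k' : ℕ} (hk : k ≤ k') {v : Fin (nn + 1)} (h : ReachIn src tgt T k v) : ReachIn src tgt T k' v := by
  induction k', hk using Nat.le_induction with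
  | base => exact h
  | succ k' _ ih => exact reachIn_succ ih

/-- an adjacent vertex is reached one step later. [folklore] -/
theorem reachIn_step {k : ℕ} {w v : Fin (nn + 1)} (hw : ReachIn src tgt T k w) (ha : LAdjU src tgt T w v) : ReachIn src tgt T (k + 1) v :=
  Or.inr ⟨w, hw, ha⟩

/-- **connected to the external vertex ⇒ reached in finitely many steps.** [folklore] -/
theorem exists_reachIn_of_lConn {v : Fin (nn + 1)} (h : LConn src tgt T 0 v) : ∃ k, ReachIn src tgt T k v := by
  have key : ∀ u w, LConn src tgt T u w → ((∃ k, ReachIn src tgt T k u) ↔ ∃ k, ReachIn src tgt T k w) := by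
    intro u w huw
    induction huw with
    | rel a b hab =>
        obtain ⟨ℓ, hℓ, ha, hb⟩ := hab
        constructor
        · rintro ⟨k, hk⟩; exact ⟨k + 1, reachIn_step hk ⟨ℓ, hℓ, Or.inl ⟨ha, hb⟩⟩⟩
        · rintro ⟨k, hk⟩; exact ⟨k + 1, reachIn_step hk ⟨ℓ, hℓ, Or.inr ⟨ha, hb⟩⟩⟩
    | refl a => exact Iff.rfl
    | symm a b _ ih => exact ih.symm
    | trans a b c _ _ ih1 ih2 => exact ih1.trans ih2
  exact (key 0 v h).1 ⟨0, rfl⟩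

variable (hT : ∀ v, LConn src tgt T 0 v)
include hT

open Classical in
/-- **the breadth-first distance from the external vertex.** [folklore] -/
def bdist (v : Fin (nn + 1)) : ℕ := Nat.find (exists_reachIn_of_lConn (hT v))

open Classical in
/-- the distance is attained. [folklore] -/
theorem reachIn_bdist (v : Fin (nn + 1)) : ReachIn src tgt T (bdist hT v) v := Nat.find_spec (exists_reachIn_of_lConn (hT v))

open Classical in
/-- the distance is minimal. [folklore] -/
theorem bdist_le {v : Fin (nn + 1)} {k : ℕ} (h : ReachIn src tgt T k v) : bdist hT v ≤ k := Nat.find_min' _ h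

/-- only the external vertex is at distance `0`. [folklore] -/
theorem bdist_eq_zero_iff (v : Fin (nn + 1)) : bdist hT v = 0 ↔ v = 0 := by
  constructor
  · intro h
    have h1 := reachIn_bdist hT v
    rw [h] at h1
    exact h1
  · rintro rfl
    exact Nat.le_zero.1 (bdist_le hT (show ReachIn src tgt T 0 0 from rfl))

/-- **the last step of a shortest chain**: a non-external vertex has a neighbour one step closer. [folklore] -/
theorem exists_parent {v : Fin (nn + 1)} (hv : v ≠ 0) :
    ∃ w, bdist hT w < bdist hT v ∧ LAdjU src tgt T w v := by
  obtain ⟨k, hk⟩ : ∃ k, bdist hT v = k + 1 := Nat.exists_eq_succ_of_ne_zero (fun h => hv ((bdist_eq_zero_iff hT v).1 h))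
  have h1 := reachIn_bdist hT v
  rw [hk] at h1
  rcases h1 with h | ⟨w, hw, ha⟩
  · exact absurd (bdist_le hT h) (by omega)
  · exact ⟨w, lt_of_le_of_lt (bdist_le hT hw) (by omega), ha⟩

/-- **the breadth-first parent** of a non-external vertex. [folklore] -/
def bparent {v : Fin (nn + 1)} (hv : v ≠ 0) : Fin (nn + 1) := Classical.choose (exists_parent hT hv)

/-- the parent is strictly closer. [folklore] -/
theorem bdist_bparent_lt {v : Fin (nn + 1)} (hv : v ≠ 0) : bdist hT (bparent hT hv) < bdist hT v := (Classical.choose_spec (exists_parent hT hv)).1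

/-- the parent is a neighbour through `T`. [folklore] -/
theorem ladjU_bparent {v : Fin (nn + 1)} (hv : v ≠ 0) : LAdjU src tgt T (bparent hT hv) v := (Classical.choose_spec (exists_parent hT hv)).2

/-- **the tree line of a vertex**: a line of `T` joining it to its parent. [folklore] -/
def bline {v : Fin (nn + 1)} (hv : v ≠ 0) : Fin m := Classical.choose (ladjU_bparent hT hv)

/-- the tree line lies in `T`. [folklore] -/
theorem bline_mem {v : Fin (nn + 1)} (hv : v ≠ 0) : bline hT hv ∈ T := (Classical.choose_spec (ladjU_bparent hT hv)).1

/-- the tree line joins the parent and the vertex. [folklore] -/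
theorem bline_ends {v : Fin (nn + 1)} (hv : v ≠ 0) :
    (src (bline hT hv) = bparent hT hv ∧ tgt (bline hT hv) = v) ∨ (src (bline hT hv) = v ∧ tgt (bline hT hv) = bparent hT hv) :=
  (Classical.choose_spec (ladjU_bparent hT hv)).2

/-- **distinct vertices have distinct tree lines** (a shared line would make each the parent of the other). [folklore] -/
theorem bline_injective {v w : Fin (nn + 1)} (hv : v ≠ 0) (hw : w ≠ 0) (h : bline hT hv = bline hT hw) : v = w := by
  have hdv := bdist_bparent_lt hT hv
  have hdw := bdist_bparent_lt hT hw
  rcases bline_ends hT hv with ⟨h1, h2⟩ | ⟨h1, h2⟩ <;> rcases bline_ends hT hw with ⟨h3, h4⟩ | ⟨h3, h4⟩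
  · rw [h] at h2; exact h2.symm.trans h4
  · rw [h] at h1 h2
    have e1 : bparent hT hv = w := h1.symm.trans h3
    have e2 : v = bparent hT hw := h2.symm.trans h4
    rw [e1] at hdv; rw [← e2] at hdw
    exact absurd (hdv.trans hdw) (lt_irrefl _)
  · rw [h] at h1 h2
    have e1 : v = bparent hT hw := h1.symm.trans h3
    have e2 : bparent hT hv = w := h2.symm.trans h4
    rw [e2] at hdv; rw [← e1] at hdw
    exact absurd (hdv.trans hdw) (lt_irrefl _)
  · rw [h] at h1; exact h1.symm.trans h3

/-! ### The breadth-first numbering -/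

/-- the sort key: distance first, then the vertex. [folklore] -/
def bkey (v : Fin (nn + 1)) : ℕ := bdist hT v * (nn + 1) + (v : ℕ)

/-- a closer vertex has a smaller key. [folklore] -/
theorem bkey_lt_of_bdist_lt {u v : Fin (nn + 1)} (h : bdist hT u < bdist hT v) : bkey hT u < bkey hT v := by
  unfold bkey
  have hu : (u : ℕ) < nn + 1 := u.isLt
  nlinarith [Nat.succ_le_of_lt h]

/-- **THE BREADTH-FIRST NUMBERING** `ρ`: the rank of a vertex when the vertices are sorted by (distance, index). [folklore] -/
def bnum : Equiv.Perm (Fin (nn + 1)) := (Tuple.sort (bkey hT)).symm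

/-- the numbering is increasing in the key. [folklore] -/
theorem bnum_lt_of_bkey_lt {u v : Fin (nn + 1)} (h : bkey hT u < bkey hT v) : bnum hT u < bnum hT v := by
  by_contra hle
  have hmono := Tuple.monotone_sort (bkey hT) (not_lt.1 hle)
  simp only [Function.comp_apply] at hmono
  unfold bnum at hmono
  rw [Equiv.apply_symm_apply, Equiv.apply_symm_apply] at hmono
  exact absurd hmono (not_le.2 h)

/-- the parent gets a smaller number. [folklore] -/
theorem bnum_bparent_lt {v : Fin (nn + 1)} (hv : v ≠ 0) : bnum hT (bparent hT hv) < bnum hT v :=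
  bnum_lt_of_bkey_lt hT (bkey_lt_of_bdist_lt hT (bdist_bparent_lt hT hv))

/-- the external vertex keeps the number `0`. [folklore] -/
theorem bnum_zero : bnum hT 0 = 0 := by
  have hle : ∀ w : Fin (nn + 1), bnum hT 0 ≤ bnum hT w := by
    intro w
    by_cases hw : w = 0
    · rw [hw]
    · refine (bnum_lt_of_bkey_lt hT ?_).le
      have h0 : bdist hT 0 = 0 := (bdist_eq_zero_iff hT 0).2 rfl
      unfold bkey
      rw [h0, zero_mul, zero_add, Fin.val_zero]
      have : (w : ℕ) ≠ 0 := fun h => hw (Fin.ext h)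
      have : 0 ≤ bdist hT w * (nn + 1) := Nat.zero_le _
      omega
  have h := hle ((bnum hT).symm 0)
  rw [Equiv.apply_symm_apply] at h
  exact le_antisymm h (Fin.zero_le _)

/-- a vertex with a positive number is not the external vertex. [folklore] -/
theorem bnum_symm_succ_ne_zero (i : Fin nn) : (bnum hT).symm i.succ ≠ 0 := fun h => by
  have h1 := congrArg (bnum hT) h
  rw [Equiv.apply_symm_apply, bnum_zero] at h1
  exact Fin.succ_ne_zero i h1

/-! ### The certificate of a connecting line set -/

/-- ★★ **THE BREADTH-FIRST CERTIFICATE OF A CONNECTING SET OF LINES**: renumber the vertices breadth-first from the external vertex; every other vertex hangs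
on its parent (a smaller number) by its tree line. [cite: King1986, p.664 («Graphically, we have shrunk l(1) to a point in H; the remaining vertices are summed»)] -/
def bfsCertR : ForestCertR nn src tgt where
  ρ := bnum hT
  ρ_zero := bnum_zero hT
  F :=
    { tl := fun i => bline hT (bnum_symm_succ_ne_zero hT i)
      tl_injective := fun i j h => by
        have h1 := bline_injective hT _ _ h
        exact Fin.succ_injective _ ((bnum hT).symm.injective h1)
      lo := fun i => bnum hT (bparent hT (bnum_symm_succ_ne_zero hT i))
      lo_le := fun i => by
        have h := bnum_bparent_lt hT (bnum_symm_succ_ne_zero hT i)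
        rw [Equiv.apply_symm_apply] at h
        exact Fin.le_castSucc_iff.2 h
      ends := fun i => by
        rcases bline_ends hT (bnum_symm_succ_ne_zero hT i) with ⟨h1, h2⟩ | ⟨h1, h2⟩
        · left
          refine ⟨?_, ?_⟩
          · show bnum hT (src _) = _; rw [h1]
          · show bnum hT (tgt _) = _; rw [h2, Equiv.apply_symm_apply]
        · right
          refine ⟨?_, ?_⟩
          · show bnum hT (src _) = _; rw [h1, Equiv.apply_symm_apply]
          · show bnum hT (tgt _) = _; rw [h2] }

/-- the certificate's tree lines lie in `T`. [folklore] -/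
theorem image_bfsCertR_subset : (univ : Finset (Fin nn)).image (bfsCertR hT).F.tl ⊆ T := by
  intro ℓ hℓ
  obtain ⟨i, -, rfl⟩ := mem_image.1 hℓ
  exact bline_mem hT _

/-- the certificate has `nn` distinct tree lines. [folklore] -/
theorem card_image_bfsCertR : ((univ : Finset (Fin nn)).image (bfsCertR hT).F.tl).card = nn := by
  rw [card_image_of_injective _ (bfsCertR hT).F.tl_injective, card_univ, Fintype.card_fin]

end BFS

/-! ## §2 Kruskal's certificate: its tree lines are exactly Kruskal's tree lines of the ordering -/

section KruskalCert
variable {nn m : ℕ} {src tgt : Fin m → Fin (nn + 1)}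

/-- ★★★ **FOR A CONNECTED GRAPH AND EVERY ORDERING OF ITS LINES THERE IS A (relabelled) SPANNING-FOREST CERTIFICATE WHOSE TREE LINES ARE EXACTLY KRUSKAL's** —
the breadth-first certificate of Kruskal's tree (which connects every vertex to the external one and has exactly `nn` lines).  Consequently its order list is
King's: exponent `e + dV` at the positions whose line reaches a new point, `e` at the loop-closing ones — partial sums = `D(H_i)` (3.66).
[cite: King1986, (3.66) p.663, p.664 («Let x, y be the endpoints of the graph H₁ = l(1) … We then sum over y … Graphically, we have shrunk l(1) to a point in H»)] -/
theorem exists_certR_kruskal (hconn : ∀ v, LConn src tgt univ 0 v) (π : Equiv.Perm (Fin m)) :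
    ∃ FR : ForestCertR nn src tgt, (univ : Finset (Fin nn)).image FR.F.tl = kruskalTree src tgt π := by
  refine ⟨bfsCertR (lConn_kruskalTree (π := π) hconn), ?_⟩
  exact eq_of_subset_of_card_le (image_bfsCertR_subset _) (by rw [card_image_bfsCertR, card_kruskalTree hconn])

end KruskalCert

end Summit.QuantumFields.YangMills.BalabanUVNodes.N15KingModelRung.Graph

namespace Summit.QuantumFields.YangMills.BalabanUVNodes.N15KingModelRung.Curved

open scoped BigOperators
open Finset
open Literature.MathematicalPhysics.QuantumFieldTheory.Balaban1983to89.B5Prop11Plancherel (Tor fine unitVec)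
open Summit.QuantumFields.YangMills.BalabanUVNodes.N15KingModelRung (KingVolIndex kingVol kingVol_neZero)
open Summit.QuantumFields.YangMills.BalabanUVNodes.N15KingModelRung.Graph

variable {d : ℕ} (L : ℕ) [NeZero L]

/-! ## §3 King's degrees (3.66)∕(3.77) intrinsically, and Proposition 3.6 for connected graphs in King's own hypothesis -/

section KingDegrees
variable {nn m : ℕ} (src tgt : Fin m → Fin (nn + 1))

omit [NeZero L] in
/-- **KING's EXPONENT LIST OF AN ORDERING** (coarsest line first): the line at a position whose line reaches a new point of the shrunk graph (a Kruskal tree line)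
carries `e + dV` (its size power plus the vertex sum (3.68)), a loop-closing line carries `e`; the partial sums from the finest line are King's degrees
`D(H_1), D(H_2), …` of (3.66) — (3.77) asks them to be positive. [cite: King1986, (3.66) p.663, (3.68) p.664, (3.77) p.666] -/
def kingDegList (dV : ℝ) (e : Fin m → ℝ) (π : Equiv.Perm (Fin m)) : List ℝ :=
  List.ofFn fun p : Fin m => e (π (Fin.rev p)) + if π (Fin.rev p) ∈ kruskalTree src tgt π then dV else 0

variable {src tgt}

omit [NeZero L] in
/-- the order list of a certificate whose tree lines are Kruskal's IS King's exponent list. [cite: King1986, (3.66) p.663] -/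
theorem orderList_eq_kingDegList (dV : ℝ) (e : Fin m → ℝ) (π : Equiv.Perm (Fin m)) (FR : ForestCertR nn src tgt)
    (h : (univ : Finset (Fin nn)).image FR.F.tl = kruskalTree src tgt π) : orderList dV e π FR.F = kingDegList src tgt dV e π := by
  unfold orderList orderExps kingDegList
  simp_rw [h]

/-- ★★★ **KING 1986 PROPOSITION 3.6 (3.56) FOR CONNECTED GRAPHS IN KING's OWN HYPOTHESIS (3.77), BY NAME AT `A = 0`**: part Γ-i's theorem with the certificates
DISCHARGED — for a connected numbered graph it suffices that King's degrees `D(H_i)` (the partial sums of `kingDegList`, Kruskal tree lines computed from the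
ordering) exceed a margin `γ₁ > 0` along every ordering; same constants and bound as `king_prop36_graph_zeroField_R`.
[cite: King1986, Prop. 3.6 (3.56) p.662, (3.66) p.663, (3.77) p.666, pp.663–665] -/
theorem king_prop36_graph_zeroField_kruskal (hLodd : Odd L) (hL : 2 ≤ L) {a : ℝ} (ha : 0 < a) {m0sq : ℝ} (hm0 : 0 ≤ m0sq) :
    ∃ C₁ C₂ γ₀ : ℝ, 0 < C₁ ∧ 0 < C₂ ∧ 0 < γ₀ ∧ ∀ (msq : ℝ), 0 < msq → msq ≤ m0sq → ∀ (jv : KingVolIndex d) (n : ℕ), 1 ≤ n →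
      ∀ (nn m : ℕ) (src tgt : Fin m → Fin (nn + 1)), (∀ v, LConn src tgt univ 0 v) →
      ∀ (κ : Fin m → Option (Fin (d + 1))) (Υ : Type) [Fintype Υ] [DecidableEq Υ]
        (vtx : Υ → Fin (nn + 1)) (υ₀ : Υ), vtx υ₀ = 0 →
        haveI := kingVol_neZero L jv
        ∀ (u : Υ → Tor (fine (L ^ jv.K) (kingVol L jv)) → ℝ) (u' : Υ → Tor (fine (L ^ (jv.K + n)) (kingVol L jv)) → ℝ)
          (qq s : Υ → ℝ) (p₀ r₀ : Tor (fine (L ^ jv.K) (kingVol L jv)) → ℝ) (Γ Γ' γ₁ : ℝ),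
          (∀ υ, 0 ≤ qq υ) → (∀ υ, 0 ≤ s υ) → (∀ x, 0 ≤ r₀ x) →
          (∀ υ, υ ≠ υ₀ → ∀ x, |u υ x| ≤ qq υ) → (∀ υ, υ ≠ υ₀ → ∀ x', |u' υ x'| ≤ qq υ) →
          (∀ υ, υ ≠ υ₀ → ∀ x', |u' υ x' - u υ (kingSlicePt L jv.K n (kingVol L jv) x')| ≤ s υ * qq υ) →
          (∀ x, |u υ₀ x| ≤ p₀ x) → (∀ x', |u' υ₀ x'| ≤ p₀ (kingSlicePt L jv.K n (kingVol L jv) x')) →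
          (∀ x', |u' υ₀ x' - u υ₀ (kingSlicePt L jv.K n (kingVol L jv) x')| ≤ r₀ (kingSlicePt L jv.K n (kingVol L jv) x')) →
          (∑ x, (((L : ℝ) ^ jv.K)⁻¹) ^ (d + 1) * p₀ x ≤ Γ) → (∑ x, (((L : ℝ) ^ jv.K)⁻¹) ^ (d + 1) * r₀ x ≤ Γ') → 0 < γ₁ →
          (∀ π : Equiv.Perm (Fin m), PosDegreesBy γ₁ (kingDegList src tgt ((d + 1 : ℕ) : ℝ) (fun ℓ => lineExp (d + 1) (κ ℓ)) π)) →
            |graphValLS ((((L : ℝ) ^ (jv.K + n))⁻¹) ^ (d + 1)) src tgt (fun ℓ => kingGLine L (kingVol L jv) a msq (jv.K + n) (κ ℓ)) vtx u'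
                - graphValLS ((((L : ℝ) ^ jv.K)⁻¹) ^ (d + 1)) src tgt (fun ℓ => kingGLine L (kingVol L jv) a msq jv.K (κ ℓ)) vtx u|
              ≤ (Γ' + Γ * ((L : ℝ) ^ (-(min γ₀ (γ₁ / 2) * jv.K)) * (m + 1) + ∑ υ ∈ univ.erase υ₀, s υ))
                * (C₁ ^ m * C₂ ^ nn * ((m.factorial : ℝ) * ((1 - (L : ℝ) ^ (-(γ₁ / 2)))⁻¹) ^ m) * ∏ υ ∈ univ.erase υ₀, qq υ) := by
  obtain ⟨C₁, C₂, γ₀, hC₁, hC₂, hγ₀, H⟩ := king_prop36_graph_zeroField_R (d := d) L hLodd hL ha hm0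
  refine ⟨C₁, C₂, γ₀, hC₁, hC₂, hγ₀, fun msq hm hcap jv n hn nn m src tgt hconn κ Υ _ _ vtx υ₀ hυ₀ u u' qq s p₀ r₀ Γ Γ' γ₁
    hqq hs hr₀ hu hu' hus hp₀ hp₀' hr₀' hΓ hΓ' hγ₁ hking => ?_⟩
  -- Kruskal's certificates, one per ordering
  have hex := fun π : Equiv.Perm (Fin m) => exists_certR_kruskal hconn π
  refine H msq hm hcap jv n hn nn m src tgt κ Υ vtx υ₀ hυ₀ u u' qq s p₀ r₀ Γ Γ' γ₁ hqq hs hr₀ hu hu' hus hp₀ hp₀' hr₀' hΓ hΓ' hγ₁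
    (fun π => Classical.choose (hex π)) fun π => ?_
  rw [orderList_eq_kingDegList _ _ π _ (Classical.choose_spec (hex π))]
  exact hking π

end KingDegrees

end Summit.QuantumFields.YangMills.BalabanUVNodes.N15KingModelRung.Curved

end
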